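import Literature.AlgebraicGeometry.AbelianVarieties.RelativeFourierExchangeTranslationSnd
import Literature.AlgebraicGeometry.AbelianVarieties.MarkmanPhiExchange
import HarnessLib

/-!
# Markman's `Φ = (id × Ψ_{𝒫⁻¹}) ∘ μ^*` and translations of the SECOND factor of `A × A`: the diagonal translation row
# `D⁺(t_{(c,c)}^*) ⋙ Φ ≅ Φ ⋙ D⁺(p_Â^*((P̂_{c⁻¹})^∨) ⊗ –)` and the second-factor row
# `D⁺((1 × t_c)^*) ⋙ Φ ≅ Φ ⋙ D⁺((t_{c⁻¹} × 1)^*) ⋙ D⁺(p_Â^*((P̂_{c⁻¹})^∨) ⊗ –)` (Markman 2025 §6, §9.3; Mukai 1981 (3.1))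

Layer `Literature/AlgebraicGeometry/AbelianVarieties`; sequel to `RelativeFourierExchangeTranslationSnd` (ROW (iii)
`relativeTransform_translationSnd_iso : D⁺((1_A × t_b)^*) ⋙ (id × Ψ_K) ≅ (id × Ψ_K) ⋙ D⁺(pr_C^*L ⊗ –)` given `φ : (t_b × 1)⁻¹^*K ≅ K ⊗ pr_C^*L`)
and `MarkmanPhiExchange` (rows Φ-(i)–(iii), `prodTranslationSchemeIso`). For a principally polarised complex abelian variety `(A, Θ)`
(`Â = A.dualOf Θ hΘ`, `𝒫`, `P̂_x = linePtHat A hΘ hK x` on `Â`, `Φ = markmanPhiPlus A hΘ hK`) this file PROVES (0 named facts, no instances),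
as isomorphisms of FUNCTORS `D⁺(Mod 𝒪_{A×A}) ⥤ D⁺(Mod 𝒪_{A×Â})`:

* §1 the datum for the DUAL Poincaré kernel, **`(t_c × 1)⁻¹^*𝒫^∨ ≅ 𝒫^∨ ⊗ p_Â^*((P̂_{c⁻¹})^∨)`** (Lange's Lemma 6.1.3 at `(c⁻¹, 1)` in class
  currency — `detClass_dual`, `pullback_prodTranslation_detClass_poincareSheaf`, `nonempty_iso_iff_detClass_eq`; one CHOSEN representative,
  `(P̂_{c⁻¹})^∨` NOT rewritten as `P̂_c`);
* §2 the shear and translations of the second factor: **`(1 × t_c) ≫ μ = μ ≫ t_{(c,c)}`** (`μ(x₁, x₂c) = (x₁x₂c, x₂c)`) — so `1 × t_c` does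
  NOT commute with `μ`: it is the DIAGONAL translation `t_{(c,c)}` of `A × A` that `μ` turns into `1 × t_c` — whence
  `t_{(c,c)}^* ⋙ μ^* ≅ μ^* ⋙ (1 × t_c)^*`; and `(1 × t_c) = t_{(c,c)} ≫ (t_{c⁻¹} × 1)`;
* §3 **ROW Φ-(iv) `markmanPhi_diagTranslation_iso : D⁺(t_{(c,c)}^*) ⋙ Φ ≅ Φ ⋙ D⁺(p_Â^*((P̂_{c⁻¹})^∨) ⊗ –)`** (diagonal translation of `A × A`
  ↦ twist by the pulled-back Pic⁰ slice on `A × Â`), **ROW Φ-(v) `markmanPhi_translationSnd_iso :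
  D⁺((1 × t_c)^*) ⋙ Φ ≅ Φ ⋙ D⁺((t_{c⁻¹} × 1)^*) ⋙ D⁺(p_Â^*((P̂_{c⁻¹})^∨) ⊗ –)`** (translation of the second factor alone picks up, besides
  the twist, the translation `t_{c⁻¹} × 1` of the `A`-factor of `A × Â` — ROW Φ-(iv) composed with ROW Φ-(i) at `c⁻¹`), each with its
  objectwise `Nonempty` reading (instances discharged).

Print: "`Φ := (id × Ψ_{𝒫⁻¹[n]}) ∘ μ^*`" [Markman §6 p. 26 L51]; the conjugation of translations and Pic⁰-twists through `Φ̃` [§9.3 p. 71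
L46–69]; Mukai (3.1) [§3 p. 158]. The SHIFT `[n]` and the twist `[Θ ⊠ Θ] ⊗` of print are omitted as in `MarkmanShearFourierFunctor`. NOT here:
compatibilities between the rows at different points; Mukai's Thm. 2.2. Typed for the cell `pub-hodge-ring2` (library row (N4) of the E1 scoping
memo of crux 26512: with ROW Φ-(iv) and ROW Φ-(iii), `Φ((t_a × 1)^*(p₂^*P_α^∨ ⊗ t_{(c,c)}^*X)) ≅ t_{(a,α)}^*(p_Â^*(P̂_{c⁻¹})^∨ ⊗ Φ(X))`);
a research route conditional on HC_CM, not a corollary — nothing in this file refers to it.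

## References

* E. Markman, *Cycles on abelian 2n-folds of Weil type from secant sheaves on abelian n-folds*, arXiv:2502.03415 (2025), §6 p. 26
  L34–51, §9.3 p. 71 L46–69. [Markman2025SecantWeil]
* S. Mukai, *Duality between `D(X)` and `D(X̂)` with its application to Picard sheaves*, Nagoya Math. J. 81 (1981), §3 (3.1)
  p. 158. [Mukai1981]
* H. Lange, *Abelian Varieties over the Complex Numbers* (2023), §6.1.1 Lemma 6.1.3, Lemma 6.1.2. [Lange2023AbelianVarietiesComplex]
* U. Görtz, T. Wedhorn, *Algebraic Geometry II* (2023), Def./Rem. 27.1 (p. 799). [GortzWedhorn2023]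
* R. Hartshorne, *Algebraic Geometry* (1977), III Prop. 9.3. [Hartshorne1977]
-/

noncomputable section

-- `TopCat.Presheaf`/`Scheme.Modules` are not reducible (as in Mathlib's `AlgebraicGeometry/Modules/Sheaf.lean`).
set_option backward.isDefEq.respectTransparency false

open CategoryTheory CategoryTheory.Limits AlgebraicGeometry MonoidalCategory CartesianMonoidalCategory
open AlgebraicGeometry.Scheme.Modules

universe w₁ w₂ w₃ u

namespace Literature.AlgebraicGeometry.AbelianVarieties

open Literature.AlgebraicGeometry.Motives Literature.AlgebraicGeometry.Modules
open scoped MonObj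

/-! ### §1 The datum for the dual Poincaré kernel: `(t_c × 1)⁻¹^*𝒫^∨ ≅ 𝒫^∨ ⊗ p_Â^*((P̂_{c⁻¹})^∨)` -/

section Datum

variable (A : AbelianVariety ℂ) {Θ : CartierDivisor A.X.left} (hΘ : Θ.IsAmple) (hK : A.KTheta Θ = ⊥) (c : A.Points ℂ)

/-- `t_a × 1_Â = t_{(a,1)}` on `A × Â` (whiskering vs translation of the product: same components). [cite: GortzWedhorn2023, Def./Rem. 27.1 (p. 799)] -/
theorem whiskerRight_translation_eq_prodTranslation (a : A.Points ℂ) :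
    A.translation a ▷ (A.dualOf Θ hΘ).X = prodTranslation A (A.dualOf Θ hΘ) (prodUnitPoint A hΘ a) := by
  ext
  · rw [whiskerRight_fst, prodTranslation_comp_fst, prodUnitPoint_comp_fst]
  · rw [whiskerRight_snd, prodTranslation_comp_snd, prodUnitPoint_comp_snd, AbelianVariety.translation_one, Category.comp_id]

/-- `(t_c × 1)⁻¹ = t_{(c⁻¹,1)}` on underlying schemes. [cite: GortzWedhorn2023, Def./Rem. 27.1 (p. 799)] -/
theorem fstTranslationIso_inv_eq :
    (fstTranslationIso A c (A.dualOf Θ hΘ)).inv = (prodTranslation A (A.dualOf Θ hΘ) (prodUnitPoint A hΘ c⁻¹)).left := by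
  change (A.translation c⁻¹ ▷ (A.dualOf Θ hΘ).X).left = _
  rw [whiskerRight_translation_eq_prodTranslation]

/-- **Lange 6.1.3 for the DUAL kernel at `(c⁻¹, 1)`: `(t_c × 1)⁻¹^*𝒫^∨ ≅ 𝒫^∨ ⊗ p_Â^*((P̂_{c⁻¹})^∨)`** in `tensorObj` currency (classes:
`t_{(c⁻¹,1)}^*[𝒫]⁻¹ = ([𝒫]·p_A^*[P_1]·p_Â^*[P̂_{c⁻¹}])⁻¹ = [𝒫]⁻¹·p_Â^*[P̂_{c⁻¹}]⁻¹`). [cite: Lange2023AbelianVarietiesComplex, §6.1.1 Lemma 6.1.3 and Lemma 6.1.2]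
[cite: Mukai1981, §3 p. 158 L6–8] -/
theorem nonempty_pullback_fstTranslation_inv_dualPoincareSheaf_iso :
    Nonempty ((Scheme.Modules.pullback (fstTranslationIso A c (A.dualOf Θ hΘ)).inv).obj (Modules.dual (poincareSheaf A hΘ hK)) ≅
      tensorObj (Modules.dual (poincareSheaf A hΘ hK))
        ((Scheme.Modules.pullback (snd A.X (A.dualOf Θ hΘ).X).left).obj (Modules.dual (linePtHat A hΘ hK c⁻¹)))) := by
  have h𝒫 := isFiniteLocallyFree_poincareSheaf A hΘ hK
  have h𝒫₁ := hasRank_poincareSheaf A hΘ hK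
  have hP := isFiniteLocallyFree_linePtHat A hΘ hK c⁻¹
  have hP₁ := hasRank_linePtHat A hΘ hK c⁻¹
  have hD := isFiniteLocallyFree_dual h𝒫
  have hD₁ := hasRank_dual h𝒫₁
  have hQ := isFiniteLocallyFree_dual hP
  have hQ₁ := hasRank_dual hP₁
  refine (nonempty_iso_iff_detClass_eq (hasRank_pullback _ hD₁) (hasRank_tensorObj_one hD₁ (hasRank_pullback _ hQ₁))
    (hD.pullback _) (isFiniteLocallyFree_tensorObj _ _ hD (hQ.pullback _))).2 ?_
  rw [detClass_pullback _ hD, detClass_tensorObj_of_hasRank_one hD₁ (hasRank_pullback _ hQ₁) hD (hQ.pullback _),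
    detClass_pullback _ hQ, detClass_dual h𝒫, detClass_dual hP, fstTranslationIso_inv_eq, map_inv,
    pullback_prodTranslation_detClass_poincareSheaf, prodUnitPoint_comp_snd, prodUnitPoint_comp_fst, detClass_linePt_one,
    map_one, mul_one, mul_inv, map_inv]

/-- A chosen isomorphism `(t_c × 1)⁻¹^*𝒫^∨ ≅ 𝒫^∨ ⊗ p_Â^*((P̂_{c⁻¹})^∨)`. [cite: Lange2023AbelianVarietiesComplex, §6.1.1 Lemma 6.1.3] -/
def pullbackFstTranslationInvDualPoincareSheafIso :
    (Scheme.Modules.pullback (fstTranslationIso A c (A.dualOf Θ hΘ)).inv).obj (Modules.dual (poincareSheaf A hΘ hK)) ≅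
      tensorObj (Modules.dual (poincareSheaf A hΘ hK))
        ((Scheme.Modules.pullback (snd A.X (A.dualOf Θ hΘ).X).left).obj (Modules.dual (linePtHat A hΘ hK c⁻¹))) :=
  (nonempty_pullback_fstTranslation_inv_dualPoincareSheaf_iso A hΘ hK c).some

end Datum

/-! ### §2 The shear and translations of the second factor: `(1 × t_c) ≫ μ = μ ≫ t_{(c,c)}` -/

section Shear

variable (A : AbelianVariety ℂ) (c : A.Points ℂ)

/-- The diagonal complex point `(c, c)` of `A × A`. [cite: Markman2025SecantWeil, §6 p. 26 L34] -/
def prodDiagPoint : (A.prod A).Points ℂ :=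
  lift c c

/-- `(c, c) ≫ p₁ = c`. [cite: Markman2025SecantWeil, §6 p. 26 L34] -/
@[simp]
theorem prodDiagPoint_comp_fst : prodDiagPoint A c ≫ fst A.X A.X = c := lift_fst _ _

/-- `(c, c) ≫ p₂ = c`. [cite: Markman2025SecantWeil, §6 p. 26 L34] -/
@[simp]
theorem prodDiagPoint_comp_snd : prodDiagPoint A c ≫ snd A.X A.X = c := lift_snd _ _

/-- **`(1 × t_c) ≫ μ = μ ≫ t_{(c,c)}`** (`μ(x₁, x₂c) = (x₁x₂c, x₂c) = t_{(c,c)}(μ(x₁, x₂))`, `A` commutative): the shear carries the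
DIAGONAL translation of `A × A` to the translation of the second factor. [cite: Markman2025SecantWeil, §6 p. 26 L34] -/
theorem whiskerLeft_translation_comp_shear :
    (A.X ◁ A.translation c) ≫ (shearIso A).hom = (shearIso A).hom ≫ prodTranslation A A (prodDiagPoint A c) := by
  ext
  · rw [Category.assoc, shearIso_hom_comp_fst, MonObj.comp_mul, whiskerLeft_fst, whiskerLeft_snd, Category.assoc,
      prodTranslation_comp_fst, prodDiagPoint_comp_fst, ← Category.assoc, shearIso_hom_comp_fst,
      AbelianVariety.comp_translation_eq_mul, AbelianVariety.comp_translation_eq_mul, mul_left_comm]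
  · rw [Category.assoc, shearIso_hom_comp_snd, whiskerLeft_snd, Category.assoc, prodTranslation_comp_snd, prodDiagPoint_comp_snd,
      ← Category.assoc, shearIso_hom_comp_snd]

/-- The same on underlying schemes: `(1 × t_c).hom ≫ μ.hom = μ.hom ≫ t_{(c,c)}.hom`. [cite: Markman2025SecantWeil, §6 p. 26 L34] -/
theorem sndTranslationIso_hom_comp_shear :
    (sndTranslationIso A c A).hom ≫ (shearSchemeIso A).hom =
      (shearSchemeIso A).hom ≫ (prodTranslationSchemeIso A A (prodDiagPoint A c)).hom := by
  change (A.X ◁ A.translation c).left ≫ (shearIso A).hom.left = (shearIso A).hom.left ≫ (prodTranslation A A (prodDiagPoint A c)).left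
  rw [← Over.comp_left, ← Over.comp_left, whiskerLeft_translation_comp_shear]

/-- `t_{(c,c)}^* ⋙ μ^* ≅ μ^* ⋙ (1 × t_c)^*`. [cite: Markman2025SecantWeil, §6 p. 26 L34] -/
def pullbackDiagTranslationShearIso :
    Scheme.Modules.pullback (prodTranslationSchemeIso A A (prodDiagPoint A c)).hom ⋙ Scheme.Modules.pullback (shearSchemeIso A).hom ≅
      Scheme.Modules.pullback (shearSchemeIso A).hom ⋙ Scheme.Modules.pullback (sndTranslationIso A c A).hom :=
  pullbackComp _ _ ≪≫ pullbackCongr (sndTranslationIso_hom_comp_shear A c).symm ≪≫ (pullbackComp _ _).symm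

/-- **`(1 × t_c) = t_{(c,c)} ≫ (t_{c⁻¹} × 1)`** on `A × A`. [cite: GortzWedhorn2023, Def./Rem. 27.1 (p. 799)] -/
theorem whiskerLeft_translation_eq_prodTranslation_comp_whiskerRight :
    A.X ◁ A.translation c = prodTranslation A A (prodDiagPoint A c) ≫ (A.translation c⁻¹ ▷ A.X) := by
  ext
  · rw [whiskerLeft_fst, Category.assoc, whiskerRight_fst, ← Category.assoc, prodTranslation_comp_fst, prodDiagPoint_comp_fst,
      Category.assoc, AbelianVariety.translation_comp_translation_inv, Category.comp_id]
  · rw [whiskerLeft_snd, Category.assoc, whiskerRight_snd, prodTranslation_comp_snd, prodDiagPoint_comp_snd]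

/-- `(1 × t_c)^* ≅ (t_{c⁻¹} × 1)^* ⋙ t_{(c,c)}^*` on `Mod 𝒪_{A×A}`. [cite: GortzWedhorn2023, Def./Rem. 27.1 (p. 799)] -/
def pullbackSndTranslationIsoComp :
    Scheme.Modules.pullback (sndTranslationIso A c A).hom ≅
      Scheme.Modules.pullback (fstTranslationIso A c⁻¹ A).hom ⋙
        Scheme.Modules.pullback (prodTranslationSchemeIso A A (prodDiagPoint A c)).hom :=
  pullbackCongr (show (sndTranslationIso A c A).hom =
      (prodTranslationSchemeIso A A (prodDiagPoint A c)).hom ≫ (fstTranslationIso A c⁻¹ A).hom by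
    change (A.X ◁ A.translation c).left = (prodTranslation A A (prodDiagPoint A c)).left ≫ (A.translation c⁻¹ ▷ A.X).left
    rw [← Over.comp_left, ← whiskerLeft_translation_eq_prodTranslation_comp_whiskerRight]) ≪≫
    (pullbackComp _ _).symm

end Shear

/-! ### §3 ROW Φ-(iv) (diagonal translation ↦ twist) and ROW Φ-(v) (translation of the second factor) for Markman's `Φ` -/

section Rows

variable (A : AbelianVariety ℂ) {Θ : CartierDivisor A.X.left} (hΘ : Θ.IsAmple) (hK : A.KTheta Θ = ⊥) (c : A.Points ℂ)
  [HasDerivedCategory.{w₁} (A.X ⊗ A.X).left.Modules]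
  [HasDerivedCategory.{w₂} ((A.X ⊗ A.X) ⊗ (A.dualOf Θ hΘ).X).left.Modules]
  [HasDerivedCategory.{w₃} (A.X ⊗ (A.dualOf Θ hΘ).X).left.Modules]

/-- **ROW Φ-(iv): `D⁺(t_{(c,c)}^*) ⋙ Φ ≅ Φ ⋙ D⁺(p_Â^*((P̂_{c⁻¹})^∨) ⊗ –)`** — the DIAGONAL translation of `A × A` becomes, after Markman's
`Φ`, the twist by the pulled-back dual Poincaré slice `p_Â^*((P̂_{c⁻¹})^∨)` on `A × Â` (`μ` carries `t_{(c,c)}` to `1 × t_c`; then ROW (iii)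
with the datum of §1). Exactness instances of `t_{(c,c)}^*` and of the twist are binders (`preservesFiniteLimits_pullback_prodTranslation`,
`additive_tensorBifunctor_obj`, `isInvertibleModule_of_hasRank_one`). [cite: Markman2025SecantWeil, §9.3 p. 71 L46–69]
[cite: Mukai1981, §3 (3.1) p. 158] -/
def markmanPhi_diagTranslation_iso
    [PreservesFiniteLimits (Scheme.Modules.pullback (prodTranslationSchemeIso A A (prodDiagPoint A c)).hom)]
    [((tensorBifunctor (A.X ⊗ (A.dualOf Θ hΘ).X).left).obj
      ((Scheme.Modules.pullback (snd A.X (A.dualOf Θ hΘ).X).left).obj (Modules.dual (linePtHat A hΘ hK c⁻¹)))).Additive]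
    [PreservesFiniteLimits ((tensorBifunctor (A.X ⊗ (A.dualOf Θ hΘ).X).left).obj
      ((Scheme.Modules.pullback (snd A.X (A.dualOf Θ hΘ).X).left).obj (Modules.dual (linePtHat A hΘ hK c⁻¹))))]
    [PreservesFiniteColimits ((tensorBifunctor (A.X ⊗ (A.dualOf Θ hΘ).X).left).obj
      ((Scheme.Modules.pullback (snd A.X (A.dualOf Θ hΘ).X).left).obj (Modules.dual (linePtHat A hΘ hK c⁻¹))))] :
    (Scheme.Modules.pullback (prodTranslationSchemeIso A A (prodDiagPoint A c)).hom).mapDerivedCategoryPlus ⋙ markmanPhiPlus A hΘ hK ≅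
      markmanPhiPlus A hΘ hK ⋙
        ((tensorBifunctor (A.X ⊗ (A.dualOf Θ hΘ).X).left).obj
          ((Scheme.Modules.pullback (snd A.X (A.dualOf Θ hΘ).X).left).obj (Modules.dual (linePtHat A hΘ hK c⁻¹)))).mapDerivedCategoryPlus := by
  haveI := preservesFiniteLimits_pullback_shear A
  haveI := preservesFiniteLimits_pullback_sndTranslation A c A
  have hL : IsFiniteLocallyFree (Modules.dual (linePtHat A hΘ hK c⁻¹)) := isFiniteLocallyFree_dual (isFiniteLocallyFree_linePtHat A hΘ hK c⁻¹)
  have hL₁ : HasRank (Modules.dual (linePtHat A hΘ hK c⁻¹)) 1 := hasRank_dual (hasRank_linePtHat A hΘ hK c⁻¹)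
  let t := Scheme.Modules.pullback (prodTranslationSchemeIso A A (prodDiagPoint A c)).hom
  let sh := Scheme.Modules.pullback (shearSchemeIso A).hom
  let s := Scheme.Modules.pullback (sndTranslationIso A c A).hom
  let T := relativeIntegralTransformPlus A A (A.dualOf Θ hΘ) (Modules.dual (poincareSheaf A hΘ hK))
    (isFiniteLocallyFree_dual (isFiniteLocallyFree_poincareSheaf A hΘ hK)) (hasRank_dual (hasRank_poincareSheaf A hΘ hK))
  change t.mapDerivedCategoryPlus ⋙ sh.mapDerivedCategoryPlus ⋙ T ≅ (sh.mapDerivedCategoryPlus ⋙ T) ⋙ _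
  exact (Functor.associator _ _ _).symm ≪≫
    Functor.isoWhiskerRight ((Functor.mapDerivedCategoryPlusCompIso t sh).symm ≪≫
      Functor.mapDerivedCategoryPlusIsoOfIso _ _ (pullbackDiagTranslationShearIso A c) ≪≫
      Functor.mapDerivedCategoryPlusCompIso sh s) T ≪≫
    Functor.associator _ _ _ ≪≫
    Functor.isoWhiskerLeft sh.mapDerivedCategoryPlus
      (relativeTransform_translationSnd_iso A A (A.dualOf Θ hΘ) (Modules.dual (poincareSheaf A hΘ hK))
        (isFiniteLocallyFree_dual (isFiniteLocallyFree_poincareSheaf A hΘ hK)) (hasRank_dual (hasRank_poincareSheaf A hΘ hK)) c hL hL₁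
        (pullbackFstTranslationInvDualPoincareSheafIso A hΘ hK c)) ≪≫
    (Functor.associator _ _ _).symm

/-- Objectwise form of ROW Φ-(iv) (instances discharged): `Φ(t_{(c,c)}^*E) ≅ p_Â^*((P̂_{c⁻¹})^∨) ⊗ Φ(E)` in `D⁺(Mod 𝒪_{A×Â})`.
[cite: Markman2025SecantWeil, §9.3 p. 71 L46–69] -/
theorem nonempty_markmanPhi_diagTranslation_iso (E : DerivedCategory.Plus (A.X ⊗ A.X).left.Modules) :
    Nonempty ((markmanPhiPlus A hΘ hK).obj
        ((haveI := preservesFiniteLimits_pullback_prodTranslation A A (prodDiagPoint A c)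
          (Scheme.Modules.pullback (prodTranslationSchemeIso A A (prodDiagPoint A c)).hom).mapDerivedCategoryPlus).obj E) ≅
      (haveI := additive_tensorBifunctor_obj
          ((Scheme.Modules.pullback (snd A.X (A.dualOf Θ hΘ).X).left).obj (Modules.dual (linePtHat A hΘ hK c⁻¹)))
       haveI := (isInvertibleModule_of_hasRank_one
          ((isFiniteLocallyFree_dual (isFiniteLocallyFree_linePtHat A hΘ hK c⁻¹)).pullback (snd A.X (A.dualOf Θ hΘ).X).left)
          (hasRank_pullback _ (hasRank_dual (hasRank_linePtHat A hΘ hK c⁻¹)))).preservesFiniteLimits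
       haveI := (isInvertibleModule_of_hasRank_one
          ((isFiniteLocallyFree_dual (isFiniteLocallyFree_linePtHat A hΘ hK c⁻¹)).pullback (snd A.X (A.dualOf Θ hΘ).X).left)
          (hasRank_pullback _ (hasRank_dual (hasRank_linePtHat A hΘ hK c⁻¹)))).preservesFiniteColimits
       ((tensorBifunctor (A.X ⊗ (A.dualOf Θ hΘ).X).left).obj
          ((Scheme.Modules.pullback (snd A.X (A.dualOf Θ hΘ).X).left).obj
            (Modules.dual (linePtHat A hΘ hK c⁻¹)))).mapDerivedCategoryPlus).obj
        ((markmanPhiPlus A hΘ hK).obj E)) :=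
  haveI := preservesFiniteLimits_pullback_prodTranslation A A (prodDiagPoint A c)
  haveI := additive_tensorBifunctor_obj
    ((Scheme.Modules.pullback (snd A.X (A.dualOf Θ hΘ).X).left).obj (Modules.dual (linePtHat A hΘ hK c⁻¹)))
  haveI := (isInvertibleModule_of_hasRank_one
    ((isFiniteLocallyFree_dual (isFiniteLocallyFree_linePtHat A hΘ hK c⁻¹)).pullback (snd A.X (A.dualOf Θ hΘ).X).left)
    (hasRank_pullback _ (hasRank_dual (hasRank_linePtHat A hΘ hK c⁻¹)))).preservesFiniteLimits
  haveI := (isInvertibleModule_of_hasRank_one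
    ((isFiniteLocallyFree_dual (isFiniteLocallyFree_linePtHat A hΘ hK c⁻¹)).pullback (snd A.X (A.dualOf Θ hΘ).X).left)
    (hasRank_pullback _ (hasRank_dual (hasRank_linePtHat A hΘ hK c⁻¹)))).preservesFiniteColimits
  ⟨(markmanPhi_diagTranslation_iso A hΘ hK c).app E⟩

/-- **ROW Φ-(v): `D⁺((1 × t_c)^*) ⋙ Φ ≅ Φ ⋙ D⁺((t_{c⁻¹} × 1)^*) ⋙ D⁺(p_Â^*((P̂_{c⁻¹})^∨) ⊗ –)`** — translating the SECOND factor of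
`A × A` alone becomes, after Markman's `Φ`, the translation `t_{c⁻¹} × 1` of the `A`-factor of `A × Â` followed by the twist by
`p_Â^*((P̂_{c⁻¹})^∨)` (`(1 × t_c) = t_{(c,c)} ≫ (t_{c⁻¹} × 1)`; ROW Φ-(i) at `c⁻¹` and ROW Φ-(iv)). In particular `1 × t_c` is NOT carried
to a pure twist. Exactness instances are binders. [cite: Markman2025SecantWeil, §9.3 p. 71 L46–69] [cite: Mukai1981, §3 (3.1) p. 158] -/
def markmanPhi_translationSnd_iso
    [PreservesFiniteLimits (Scheme.Modules.pullback (sndTranslationIso A c A).hom)]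
    [PreservesFiniteLimits (Scheme.Modules.pullback (fstTranslationIso A c⁻¹ (A.dualOf Θ hΘ)).hom)]
    [((tensorBifunctor (A.X ⊗ (A.dualOf Θ hΘ).X).left).obj
      ((Scheme.Modules.pullback (snd A.X (A.dualOf Θ hΘ).X).left).obj (Modules.dual (linePtHat A hΘ hK c⁻¹)))).Additive]
    [PreservesFiniteLimits ((tensorBifunctor (A.X ⊗ (A.dualOf Θ hΘ).X).left).obj
      ((Scheme.Modules.pullback (snd A.X (A.dualOf Θ hΘ).X).left).obj (Modules.dual (linePtHat A hΘ hK c⁻¹))))]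
    [PreservesFiniteColimits ((tensorBifunctor (A.X ⊗ (A.dualOf Θ hΘ).X).left).obj
      ((Scheme.Modules.pullback (snd A.X (A.dualOf Θ hΘ).X).left).obj (Modules.dual (linePtHat A hΘ hK c⁻¹))))] :
    (Scheme.Modules.pullback (sndTranslationIso A c A).hom).mapDerivedCategoryPlus ⋙ markmanPhiPlus A hΘ hK ≅
      markmanPhiPlus A hΘ hK ⋙
        (Scheme.Modules.pullback (fstTranslationIso A c⁻¹ (A.dualOf Θ hΘ)).hom).mapDerivedCategoryPlus ⋙
        ((tensorBifunctor (A.X ⊗ (A.dualOf Θ hΘ).X).left).obj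
          ((Scheme.Modules.pullback (snd A.X (A.dualOf Θ hΘ).X).left).obj (Modules.dual (linePtHat A hΘ hK c⁻¹)))).mapDerivedCategoryPlus := by
  haveI := preservesFiniteLimits_pullback_prodTranslation A A (prodDiagPoint A c)
  haveI := preservesFiniteLimits_pullback_fstTranslation A c⁻¹ A
  let s := Scheme.Modules.pullback (sndTranslationIso A c A).hom
  let t := Scheme.Modules.pullback (prodTranslationSchemeIso A A (prodDiagPoint A c)).hom
  let f := Scheme.Modules.pullback (fstTranslationIso A c⁻¹ A).hom
  let f' := Scheme.Modules.pullback (fstTranslationIso A c⁻¹ (A.dualOf Θ hΘ)).hom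
  let Tw := (tensorBifunctor (A.X ⊗ (A.dualOf Θ hΘ).X).left).obj
    ((Scheme.Modules.pullback (snd A.X (A.dualOf Θ hΘ).X).left).obj (Modules.dual (linePtHat A hΘ hK c⁻¹)))
  -- `D⁺(s) ⋙ Φ ≅ D⁺(f) ⋙ D⁺(t) ⋙ Φ ≅ D⁺(f) ⋙ Φ ⋙ D⁺(Tw) ≅ Φ ⋙ D⁺(f') ⋙ D⁺(Tw)`
  exact Functor.isoWhiskerRight (Functor.mapDerivedCategoryPlusIsoOfIso _ _ (pullbackSndTranslationIsoComp A c) ≪≫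
      Functor.mapDerivedCategoryPlusCompIso f t) (markmanPhiPlus A hΘ hK) ≪≫
    Functor.associator _ _ _ ≪≫
    Functor.isoWhiskerLeft f.mapDerivedCategoryPlus (markmanPhi_diagTranslation_iso A hΘ hK c) ≪≫
    (Functor.associator _ _ _).symm ≪≫
    Functor.isoWhiskerRight (markmanPhi_translationFst_iso A hΘ hK c⁻¹) Tw.mapDerivedCategoryPlus ≪≫
    Functor.associator _ _ _

/-- Objectwise form of ROW Φ-(v) (instances discharged): `Φ((1 × t_c)^*E) ≅ p_Â^*((P̂_{c⁻¹})^∨) ⊗ (t_{c⁻¹} × 1)^*Φ(E)` in `D⁺(Mod 𝒪_{A×Â})`.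
[cite: Markman2025SecantWeil, §9.3 p. 71 L46–69] -/
theorem nonempty_markmanPhi_translationSnd_iso (E : DerivedCategory.Plus (A.X ⊗ A.X).left.Modules) :
    Nonempty ((markmanPhiPlus A hΘ hK).obj
        ((haveI := preservesFiniteLimits_pullback_sndTranslation A c A
          (Scheme.Modules.pullback (sndTranslationIso A c A).hom).mapDerivedCategoryPlus).obj E) ≅
      (haveI := additive_tensorBifunctor_obj
          ((Scheme.Modules.pullback (snd A.X (A.dualOf Θ hΘ).X).left).obj (Modules.dual (linePtHat A hΘ hK c⁻¹)))
       haveI := (isInvertibleModule_of_hasRank_one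
          ((isFiniteLocallyFree_dual (isFiniteLocallyFree_linePtHat A hΘ hK c⁻¹)).pullback (snd A.X (A.dualOf Θ hΘ).X).left)
          (hasRank_pullback _ (hasRank_dual (hasRank_linePtHat A hΘ hK c⁻¹)))).preservesFiniteLimits
       haveI := (isInvertibleModule_of_hasRank_one
          ((isFiniteLocallyFree_dual (isFiniteLocallyFree_linePtHat A hΘ hK c⁻¹)).pullback (snd A.X (A.dualOf Θ hΘ).X).left)
          (hasRank_pullback _ (hasRank_dual (hasRank_linePtHat A hΘ hK c⁻¹)))).preservesFiniteColimits
       ((tensorBifunctor (A.X ⊗ (A.dualOf Θ hΘ).X).left).obj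
          ((Scheme.Modules.pullback (snd A.X (A.dualOf Θ hΘ).X).left).obj
            (Modules.dual (linePtHat A hΘ hK c⁻¹)))).mapDerivedCategoryPlus).obj
        ((haveI := preservesFiniteLimits_pullback_fstTranslation A c⁻¹ (A.dualOf Θ hΘ)
          (Scheme.Modules.pullback (fstTranslationIso A c⁻¹ (A.dualOf Θ hΘ)).hom).mapDerivedCategoryPlus).obj
          ((markmanPhiPlus A hΘ hK).obj E))) :=
  haveI := preservesFiniteLimits_pullback_sndTranslation A c A
  haveI := preservesFiniteLimits_pullback_fstTranslation A c⁻¹ (A.dualOf Θ hΘ)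
  haveI := additive_tensorBifunctor_obj
    ((Scheme.Modules.pullback (snd A.X (A.dualOf Θ hΘ).X).left).obj (Modules.dual (linePtHat A hΘ hK c⁻¹)))
  haveI := (isInvertibleModule_of_hasRank_one
    ((isFiniteLocallyFree_dual (isFiniteLocallyFree_linePtHat A hΘ hK c⁻¹)).pullback (snd A.X (A.dualOf Θ hΘ).X).left)
    (hasRank_pullback _ (hasRank_dual (hasRank_linePtHat A hΘ hK c⁻¹)))).preservesFiniteLimits
  haveI := (isInvertibleModule_of_hasRank_one
    ((isFiniteLocallyFree_dual (isFiniteLocallyFree_linePtHat A hΘ hK c⁻¹)).pullback (snd A.X (A.dualOf Θ hΘ).X).left)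
    (hasRank_pullback _ (hasRank_dual (hasRank_linePtHat A hΘ hK c⁻¹)))).preservesFiniteColimits
  ⟨(markmanPhi_translationSnd_iso A hΘ hK c).app E⟩

end Rows

end Literature.AlgebraicGeometry.AbelianVarieties

end
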